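import Summits.ResolutionOfSingularities.ResolutionOfSingularities.Theorems.WeightedInvariantContactCylinderTorusFactor
import Summits.ResolutionOfSingularities.ResolutionOfSingularities.Theorems.WeightedInvariantContactCylinderTorusFactorStrata
import Summits.ResolutionOfSingularities.ResolutionOfSingularities.Theorems.WeightedInvariantContactCylinderStratumLocalizeFlatT
import HarnessLib

/-!
# (c10)≤3 for the invariant of record `ι₃ᵗ = Iota3.iotaFlatT` MODULO THE NAMED LETTER INPUTS — (o44) part (c10-cyl), layer 3
# (door `HypersurfaceCentreConstruction`, stmt-ResolutionOfSingularities-19897; rung P3 `stub_keyRungLE_three`; res-type-005,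
# res-L1-w43-plan-1 GO #2 2026-08-27T13:57:22Z)

Topic: `Summits/ResolutionOfSingularities/ResolutionOfSingularities/Theorems`. Helper for the door item
`HypersurfaceCentreConstruction` (stmt-ResolutionOfSingularities-19897, route `WeightedInvariant`), def-free.  The torus-factor
clause (c10) for the flat-`τ` invariant of record `Iota3.iotaFlatT = (ι₃ᵘ ; σ-on-the-cylinder)` at every position of Krull
dimension `≤ 3`, from THREE named letter-level inputs, all at regular local rings `T` of dimension `≤ 3` and all taken as
hypotheses here (their owners: res-type-013 for `τ`, res-type-057 for `σ`):

* `h10τ` — (c10) for `ι₃ᵘ = iotaOrdEpsTau`: `ι₃ᵘ (T[X]_{𝔮₁}) (g) ≤ ι₃ᵘ T g` for primes `𝔮₁ ⊂ T[X]` over `𝔪_T`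
  ((c10ν), (c10ε) are in the tree: `iotaOrd_torusFactorMonotone`, `iotaOrdEps_torusFactorMonotone`; (c10τ) = ORDER (o49));
* `hgenτ` — the generic-fibre equality `ι₃ᵘ (T[X]_{𝔪_T T[X]}) (g) = ι₃ᵘ T g` («`ι₃ᵘ` does not drop along `T → T(X)`»;
  for `(ν ; ε)` this is `iotaOrdEps_torusFactor_eq` of res-type-013);
* `hσ` — `σ (T[X]_{𝔪_T T[X]}) (g) ≤ σ T g` at the generic fibre point (res-type-057's torus-factor inequality for `σ`).

Assembly: layer 1 (`iotaLex_iotaCylinder_torusFactor_le`, p538275) ∘ layer 2 (`topStratum_torusFactor_of_eq` with the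
plumbing `exists_ringEquiv_atPrime_polynomial`, p540970) ∘ the (strat-τ) identification `topStratum_iotaOrdEpsTau_eq`
(res-type-013) or `V(⊥)` at the junk arguments (p537453) ∘ (c6)/(c7) for `ι₃ᵘ` and (c6) + the bound for `σ` (res-type-073).

* **`Iota3.iotaFlatT_torusFactor_le`** — `iotaFlatT (S[X]_𝔮) (f) ≤ iotaFlatT S f` (`S` regular local, `dim S ≤ 3`, `𝔮` over `𝔪_S`);
* **`Iota3.iotaFlatT_torusFactorMonotoneLE`** — `IotaTorusFactorMonotoneLE 3 p Iota3.iotaFlatT` BY NAME, modulo the same.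

[OURS · L1 W4.3 · (o44) (c10-cyl) layer 3]  Replaces the role of NO printed item; NOT a statement of the manuscript
[claim: Hironaka2017, status: under-review]. AI work, weaker than expert review.

## References

* H. Matsumura, Commutative Ring Theory (1987), Thm. 4.3, §5. [Matsumura1987]
* res-L1-w43-plan-1, GO #2 13:57:22Z; IOTA3-DESIGN v1.3.1 §9.5 (OURS, AI planning).
-/

noncomputable section

open IsLocalRing Literature.AlgebraicGeometry.Resolution Polynomial
open Summit.ResolutionOfSingularities.ResolutionOfSingularities.Theorems
open Summit.ResolutionOfSingularities.ResolutionOfSingularities.Theorems.ContactCylinder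

set_option linter.dupNamespace false -- mandated namespace of this single-conjunct summit

namespace Summit.ResolutionOfSingularities.ResolutionOfSingularities.Cruxes.HypersurfaceCentreConstruction.LocalEngine

namespace Iota3

/-- **(c10) for `ι₃ᵗ` at every position of Krull dimension `≤ 3`, MODULO the named letter inputs `h10τ`, `hgenτ`, `hσ`** (module
docstring): `iotaFlatT (S[X]_𝔮) (f) ≤ iotaFlatT S f` for `S` regular local with `ringKrullDim S ≤ 3`, every `f`, every prime
`𝔮 ⊂ S[X]` over `𝔪_S`. [OURS · L1 W4.3 · (o44) (c10-cyl)] -/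
theorem iotaFlatT_torusFactor_le
    (h10τ : ∀ (T : Type) [CommRing T] [IsRegularLocalRing T] (g : T) (𝔮₁ : Ideal T[X]) [𝔮₁.IsPrime],
      ringKrullDim T ≤ 3 → 𝔮₁.comap (C : T →+* T[X]) = maximalIdeal T →
      iotaOrdEpsTau (Localization.AtPrime 𝔮₁) (algebraMap T[X] (Localization.AtPrime 𝔮₁) (C g)) ≤ iotaOrdEpsTau T g)
    (hgenτ : ∀ (T : Type) [CommRing T] [IsRegularLocalRing T] (g : T)
      [((maximalIdeal T).map (C : T →+* T[X])).IsPrime], ringKrullDim T ≤ 3 →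
      iotaOrdEpsTau (Localization.AtPrime ((maximalIdeal T).map (C : T →+* T[X])))
        (algebraMap T[X] (Localization.AtPrime ((maximalIdeal T).map (C : T →+* T[X]))) (C g)) = iotaOrdEpsTau T g)
    (hσ : ∀ (T : Type) [CommRing T] [IsRegularLocalRing T] (g : T)
      [((maximalIdeal T).map (C : T →+* T[X])).IsPrime], ringKrullDim T ≤ 3 →
      iotaSigma (Localization.AtPrime ((maximalIdeal T).map (C : T →+* T[X])))
        (algebraMap T[X] (Localization.AtPrime ((maximalIdeal T).map (C : T →+* T[X]))) (C g)) ≤ iotaSigma T g)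
    (S : Type) [CommRing S] [IsRegularLocalRing S] (hdim : ringKrullDim S ≤ 3) (f : S) (𝔮 : Ideal S[X]) [𝔮.IsPrime]
    (h𝔮 : 𝔮.comap (C : S →+* S[X]) = maximalIdeal S) :
    iotaFlatT (Localization.AtPrime 𝔮) (algebraMap S[X] (Localization.AtPrime 𝔮) (C f)) ≤ iotaFlatT S f := by
  haveI := isDomain_of_isRegularLocalRing S
  haveI : IsRegularRing S := isRegularRing_of_isRegularLocalRing S
  have hdimT : ∀ (𝔭 : Ideal S) [𝔭.IsPrime], ringKrullDim (Localization.AtPrime 𝔭) ≤ 3 := fun 𝔭 _ =>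
    (ringKrullDim_localization_atPrime_le 𝔭).trans hdim
  have h10 : iotaOrdEpsTau (Localization.AtPrime 𝔮) (algebraMap S[X] (Localization.AtPrime 𝔮) (C f)) ≤
      iotaOrdEpsTau S f := h10τ S f 𝔮 hdim h𝔮
  have hb : IotaBoundedBy ((Ordinal.omega0 + 1) * Ordinal.omega0) (iotaCylinder iotaOrdEpsTau iotaSigma) :=
    iotaBoundedBy_iotaCylinder iotaSigma_boundedBy
  have key : ∀ (P : Ideal S) [P.IsPrime], topStratum iotaOrdEpsTau S f = {𝔮₀ | P ≤ 𝔮₀.asIdeal} →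
      iotaFlatT (Localization.AtPrime 𝔮) (algebraMap S[X] (Localization.AtPrime 𝔮) (C f)) ≤ iotaFlatT S f := by
    intro P _ hE
    have hP𝔮 : P.map (C : S →+* S[X]) ≤ 𝔮 := by
      rw [Ideal.map_le_iff_le_comap, h𝔮]
      exact IsLocalRing.le_maximalIdeal (Ideal.IsPrime.ne_top ‹_›)
    have hσ' : iotaSigma (Localization.AtPrime (P.map (C : S →+* S[X]))) (algebraMap S[X] _ (C f)) ≤
        iotaSigma (Localization.AtPrime P) (algebraMap S (Localization.AtPrime P) f) := by
      obtain ⟨_, h1⟩ := iota_atPrime_map_C_eq_of_generic iotaSigma_isoInvariant S f P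
      rw [h1]
      exact hσ (Localization.AtPrime P) (algebraMap S (Localization.AtPrime P) f) (hdimT P)
    have hE' : iotaOrdEpsTau (Localization.AtPrime 𝔮) (algebraMap S[X] (Localization.AtPrime 𝔮) (C f)) =
        iotaOrdEpsTau S f →
        topStratum iotaOrdEpsTau (Localization.AtPrime 𝔮) (algebraMap S[X] (Localization.AtPrime 𝔮) (C f)) =
          {𝔮'' | (P.map (C : S →+* S[X])).map (algebraMap S[X] (Localization.AtPrime 𝔮)) ≤ 𝔮''.asIdeal} := by
      intro heq
      refine topStratum_torusFactor_of_eq iotaOrdEpsTau_isoInvariant S f P hE 𝔮 heq ?_ ?_ ?_ ?_ ?_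
      · intro _
        obtain ⟨_, h1⟩ := iota_atPrime_map_C_eq_of_generic iotaOrdEpsTau_isoInvariant S f P
        rw [h1]
        exact hgenτ (Localization.AtPrime P) (algebraMap S (Localization.AtPrime P) f) (hdimT P)
      · intro 𝔮' _ h𝔮'
        exact iota_atPrime_le_of_le iotaOrdEpsTau_isoInvariant iotaOrdEpsTau_generizationMonotone S[X] 𝔮' 𝔮 h𝔮' (C f)
      · intro 𝔮' _ _ hle
        exact iota_atPrime_le_of_le iotaOrdEpsTau_isoInvariant iotaOrdEpsTau_generizationMonotone S[X] _ 𝔮' hle (C f)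
      · intro 𝔮' _ _
        obtain ⟨𝔮₁, h𝔮₁, hmax, -, Φ, hΦ⟩ :=
          exists_ringEquiv_atPrime_polynomial S f 𝔮' (𝔮'.comap (C : S →+* S[X])) rfl
        rw [← iota_ringEquiv_atPrime (𝔫 := 𝔮') (𝔫' := 𝔮₁) iotaOrdEpsTau_isoInvariant Φ, hΦ]
        exact h10τ (Localization.AtPrime (𝔮'.comap (C : S →+* S[X]))) _ 𝔮₁ (hdimT _) hmax
      · intro 𝔭 _
        exact iotaOrdEpsTau_generizationMonotone S 𝔭 f
    unfold iotaFlatT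
    exact iotaLex_iotaCylinder_torusFactor_le iotaSigma_isoInvariant hb S f P hE 𝔮 hP𝔮 h10 hE' hσ'
  by_cases hf0 : f = 0
  · subst hf0
    exact key ⊥ (topStratum_iotaOrdEpsTau_zero_eq_bot S hdim)
  by_cases hfu : IsUnit f
  · exact key ⊥ (topStratum_iotaOrdEpsTau_of_isUnit_eq_bot S hdim hfu)
  · have hf : f ∈ maximalIdeal S := (IsLocalRing.mem_maximalIdeal f).mpr (mem_nonunits_iff.mpr hfu)
    obtain ⟨P, hP, -, -, hE⟩ := topStratum_iotaOrdEpsTau_eq hdim hf0 hf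
    haveI := hP
    exact key P hE

/-- **THE (c10)≤3 CONJUNCT OF THE P3 RUNG FOR THE INVARIANT OF RECORD, BY NAME, MODULO the named letter inputs `h10τ`,
`hgenτ`, `hσ`** (module docstring): `IotaTorusFactorMonotoneLE 3 p Iota3.iotaFlatT` for every `p` (the field binders of the
restricted clause are idle). [OURS · L1 W4.3 · (o44) (c10-cyl)] -/
theorem iotaFlatT_torusFactorMonotoneLE
    (h10τ : ∀ (T : Type) [CommRing T] [IsRegularLocalRing T] (g : T) (𝔮₁ : Ideal T[X]) [𝔮₁.IsPrime],
      ringKrullDim T ≤ 3 → 𝔮₁.comap (C : T →+* T[X]) = maximalIdeal T →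
      iotaOrdEpsTau (Localization.AtPrime 𝔮₁) (algebraMap T[X] (Localization.AtPrime 𝔮₁) (C g)) ≤ iotaOrdEpsTau T g)
    (hgenτ : ∀ (T : Type) [CommRing T] [IsRegularLocalRing T] (g : T)
      [((maximalIdeal T).map (C : T →+* T[X])).IsPrime], ringKrullDim T ≤ 3 →
      iotaOrdEpsTau (Localization.AtPrime ((maximalIdeal T).map (C : T →+* T[X])))
        (algebraMap T[X] (Localization.AtPrime ((maximalIdeal T).map (C : T →+* T[X]))) (C g)) = iotaOrdEpsTau T g)
    (hσ : ∀ (T : Type) [CommRing T] [IsRegularLocalRing T] (g : T)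
      [((maximalIdeal T).map (C : T →+* T[X])).IsPrime], ringKrullDim T ≤ 3 →
      iotaSigma (Localization.AtPrime ((maximalIdeal T).map (C : T →+* T[X])))
        (algebraMap T[X] (Localization.AtPrime ((maximalIdeal T).map (C : T →+* T[X]))) (C g)) ≤ iotaSigma T g)
    (p : ℕ) : IotaTorusFactorMonotoneLE 3 p iotaFlatT := by
  intro k₀ _ _ _ S _ _ _ _ f 𝔮 _ hdim h𝔮
  exact iotaFlatT_torusFactor_le h10τ hgenτ hσ S hdim f 𝔮 h𝔮

/-- The unrestricted clause `IotaTorusFactorMonotone iotaOrdEpsTau` ((c10) for `ι₃ᵘ`, res-type-013's ORDER (o49) in the shape of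
`iotaOrdEps_torusFactorMonotone`) supplies the input `h10τ`. [OURS · L1 W4.3 · (o44) (c10-cyl)] -/
theorem iotaOrdEpsTau_torusFactorLE_of_torusFactorMonotone (h : IotaTorusFactorMonotone iotaOrdEpsTau) :
    ∀ (T : Type) [CommRing T] [IsRegularLocalRing T] (g : T) (𝔮₁ : Ideal T[X]) [𝔮₁.IsPrime],
      ringKrullDim T ≤ 3 → 𝔮₁.comap (C : T →+* T[X]) = maximalIdeal T →
      iotaOrdEpsTau (Localization.AtPrime 𝔮₁) (algebraMap T[X] (Localization.AtPrime 𝔮₁) (C g)) ≤ iotaOrdEpsTau T g :=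
  fun T _ _ g 𝔮₁ _ _ h𝔮₁ => h T g 𝔮₁ h𝔮₁

end Iota3

end Summit.ResolutionOfSingularities.ResolutionOfSingularities.Cruxes.HypersurfaceCentreConstruction.LocalEngine

end
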